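import Summits.Ventures.HSemireg.ContractionSpanThetaSecantNondeg

/-!
# Venture HSemireg — NON-DEGENERACY of a twist / polarisation 2-vector from its top power: `Θ^N ≠ 0` gives the hypothesis `hnd`

HONEST FRAMING. Part of the Lean index of the computation cell `pub-hsemireg` (seat w3-mod4-1 gen 8, W3 SPECIAL FIBRES,
MOD4-OFFSPLIT §13: the last by-value input of THEOREM R on the real carriers after FILES 7–8 is the non-degeneracy `hnd` of the
polarisation 2-vector on `L^⊥ = (H^{0,1})^⊥`, the hypothesis of p6's `ContractionSpan.span_secant_eq` /
`exists_basis_twoVector_eq`). Finite-dimensional exterior / linear algebra over a field ONLY: no variety, no cohomology theory,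
no semiregularity map; nothing here says that HC / HC_CM / HC_AV holds; no Literature fact is declared; NO definition.

WHAT IS PROVED. For `dim V = N + N`, `dim L = N` and a 2-vector `Θ ∈ span{ι v · ι l : l ∈ L}` («type `(1,1)` w.r.t. `L`»):
**`hnd_of_pow_ne_zero`** — if `Θ^N ≠ 0` (its top divided power, «the volume `h^{2n}/(2n)! ≠ 0`»), then `Θ` is non-degenerate
on `L^⊥`: `ι(L) ⊆ span{ι_φ Θ : φ ∈ L^⊥}`. Proof: collect `Θ = Σ ι(p_i) ι(q_i)` on a basis `q` of `L` (p6's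
`exists_eq_sum_ι_mul_ι`); if `U := span p ⊔ L` were a proper subspace then `Θ` would lie in the image of `⋀² U` and `Θ^N` in the
image of `⋀^{2N} U = 0` (`dim U < 2N`, Mathlib `exteriorPower.finrank_eq`), so `U = V`, `(p, q)` is a basis of `V`
(`basisOfTopLeSpanOfCardEqFinrank`), and the coordinate forms of the `p_i` — which kill `L` — realise every `ι(q_j)` as
`ι_φ Θ = Σ φ(p_i) ι(q_i)`. So on the real carriers the polarisation's non-degeneracy is the intrinsic condition `ĥ^{2n} ≠ 0` in
`ΛH¹` (sequel). Everything PROVED, 0 sorry.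
References: [BourbakiAlgebre1a3] Ch. II §7 no. 5, Ch. III §7 no. 2 and no. 8 (`⋀^k` of a space of dimension `< k` is `0`).
-/

noncomputable section

open CliffordAlgebra (contractLeft)
open ExteriorAlgebra (ι)
open Module

namespace Summit.Ventures.HSemireg.WeilFrame

open Summit.Ventures.HSemireg.ContractionSpan

variable {K : Type*} [Field K] {V : Type*} [AddCommGroup V] [Module K V]

/-- `ι x` lies in the image of `⋀¹ U` for `x ∈ U`. -/
private lemma ι_mem_map_pow_one {U : Submodule K V} {x : V} (hx : x ∈ U) :
    ι K x ∈ (⋀[K]^1 ↥U).map (ExteriorAlgebra.map U.subtype).toLinearMap := by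
  refine ⟨ι K (⟨x, hx⟩ : ↥U), ?_, ?_⟩
  · change ι K (⟨x, hx⟩ : ↥U) ∈ LinearMap.range (ι K : ↥U →ₗ[K] ExteriorAlgebra K ↥U) ^ 1
    rw [pow_one]; exact LinearMap.mem_range_self _ _
  · rw [AlgHom.toLinearMap_apply, ExteriorAlgebra.map_apply_ι, Submodule.subtype_apply]

/-- images of exterior powers of `U` multiply degree-wise. -/
private lemma mul_mem_map_pow {U : Submodule K V} {i j : ℕ} {x y : ExteriorAlgebra K V}
    (hx : x ∈ (⋀[K]^i ↥U).map (ExteriorAlgebra.map U.subtype).toLinearMap)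
    (hy : y ∈ (⋀[K]^j ↥U).map (ExteriorAlgebra.map U.subtype).toLinearMap) :
    x * y ∈ (⋀[K]^(i + j) ↥U).map (ExteriorAlgebra.map U.subtype).toLinearMap := by
  obtain ⟨a, ha, rfl⟩ := hx
  obtain ⟨b, hb, rfl⟩ := hy
  exact ⟨a * b, SetLike.mul_mem_graded ha hb, by rw [AlgHom.toLinearMap_apply, AlgHom.toLinearMap_apply,
    AlgHom.toLinearMap_apply, map_mul]⟩

/-- powers of an element of the image of `⋀² U` lie in the images of `⋀^{2m} U`. -/
private lemma pow_mem_map_pow {U : Submodule K V} {x : ExteriorAlgebra K V}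
    (hx : x ∈ (⋀[K]^2 ↥U).map (ExteriorAlgebra.map U.subtype).toLinearMap) :
    ∀ m : ℕ, x ^ m ∈ (⋀[K]^(2 * m) ↥U).map (ExteriorAlgebra.map U.subtype).toLinearMap
  | 0 => by
    rw [mul_zero, pow_zero]
    exact ⟨1, SetLike.one_mem_graded _, by rw [AlgHom.toLinearMap_apply, map_one]⟩
  | m + 1 => by
    have h := mul_mem_map_pow (pow_mem_map_pow hx m) hx
    rw [← pow_succ] at h
    rw [show 2 * (m + 1) = 2 * m + 2 by ring]
    exact h

/-- `⋀^k U = 0` for `k > dim U`, hence its image in `ΛV` is `0`. [cite: BourbakiAlgebre1a3, Ch. III §7 no. 8] -/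
private lemma map_pow_eq_bot_of_lt [FiniteDimensional K V] (U : Submodule K V) {k : ℕ} (hk : finrank K ↥U < k) :
    (⋀[K]^k ↥U).map (ExteriorAlgebra.map U.subtype).toLinearMap = ⊥ := by
  have h0 : finrank K ↥(⋀[K]^k ↥U) = 0 := by rw [exteriorPower.finrank_eq, Nat.choose_eq_zero_of_lt hk]
  rw [Submodule.finrank_eq_zero.mp h0, Submodule.map_bot]

/-- **NON-DEGENERACY FROM THE TOP POWER.** `dim V = N + N`, `dim L = N`, `Θ ∈ span{ι v · ι l : l ∈ L}`, `Θ^N ≠ 0` ⇒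
`ι(L) ⊆ span{ι_φ Θ : φ ∈ L^⊥}` (the hypothesis `hnd` of `ContractionSpan.span_secant_eq`, of `exists_basis_twoVector_eq` and of
the Weil-frame theorems). [cite: BourbakiAlgebre1a3, Ch. II §7 no. 5] [cite: BourbakiAlgebre1a3, Ch. III §7 no. 8] -/
theorem hnd_of_pow_ne_zero [FiniteDimensional K V] {N : ℕ} (hV : finrank K V = N + N) (L : Submodule K V)
    (hL : finrank K L = N) {Θ : ExteriorAlgebra K V}
    (hΘ : Θ ∈ Submodule.span K {z : ExteriorAlgebra K V | ∃ v : V, ∃ q ∈ (L : Set V), z = ι K v * ι K q})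
    (hpow : Θ ^ N ≠ 0) :
    ∀ l ∈ (L : Set V), ι K l ∈ Submodule.span K {y : ExteriorAlgebra K V |
      ∃ φ ∈ {θ : Module.Dual K V | ∀ q ∈ L, θ q = 0}, y = contractLeft φ Θ} := by
  let qb : Basis (Fin N) K L := (Module.finBasis K L).reindex (finCongr hL)
  obtain ⟨p, hp⟩ := exists_eq_sum_ι_mul_ι L qb hΘ
  -- (1) `span p ⊔ L = V`, else `Θ^N = 0`
  obtain ⟨U, hUdef⟩ : ∃ U : Submodule K V, U = Submodule.span K (Set.range p) ⊔ L := ⟨_, rfl⟩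
  have hpi : ∀ i, p i ∈ U := fun i => by
    rw [hUdef]; exact Submodule.mem_sup_left (Submodule.subset_span (Set.mem_range_self i))
  have hqi : ∀ i, (qb i : V) ∈ U := fun i => by rw [hUdef]; exact Submodule.mem_sup_right (qb i).2
  have hU : U = ⊤ := by
    by_contra hne
    apply hpow
    have hlt : finrank K ↥U < N + N := by rw [← hV]; exact Submodule.finrank_lt hne
    have hΘU : Θ ∈ (⋀[K]^2 ↥U).map (ExteriorAlgebra.map U.subtype).toLinearMap := by
      rw [hp]
      refine Submodule.sum_mem _ fun i _ => ?_
      have h := mul_mem_map_pow (ι_mem_map_pow_one (hpi i)) (ι_mem_map_pow_one (hqi i))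
      exact h
    have h := pow_mem_map_pow hΘU N
    rw [map_pow_eq_bot_of_lt U (by omega), Submodule.mem_bot] at h
    exact h
  -- (2) `(p, q)` is a basis of `V`
  have hspan : ⊤ ≤ Submodule.span K (Set.range (Sum.elim p fun i => (qb i : V))) := by
    rw [Set.Sum.elim_range, Submodule.span_union]
    have hq : Submodule.span K (Set.range fun i => (qb i : V)) = L := by
      rw [show (fun i => (qb i : V)) = L.subtype ∘ qb from rfl, Set.range_comp, Submodule.span_image, qb.span_eq,
        Submodule.map_top, Submodule.range_subtype]
    rw [hq, ← hUdef, hU]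
  have hcard : Fintype.card (Fin N ⊕ Fin N) = finrank K V := by rw [Fintype.card_sum, Fintype.card_fin, hV]
  let b : Basis (Fin N ⊕ Fin N) K V := basisOfTopLeSpanOfCardEqFinrank _ hspan hcard
  have hb : ⇑b = Sum.elim p fun i => (qb i : V) := coe_basisOfTopLeSpanOfCardEqFinrank _ _ _
  -- the coordinate forms of the `p`-half kill `L` and are dual to `p`
  have hcoord_q : ∀ (i j : Fin N), b.coord (Sum.inl i) (qb j : V) = 0 := fun i j => by
    have : (qb j : V) = b (Sum.inr j) := by rw [hb, Sum.elim_inr]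
    rw [this, Basis.coord_apply, Basis.repr_self, Finsupp.single_apply, if_neg Sum.inr_ne_inl]
  have hcoord_p : ∀ (i j : Fin N), b.coord (Sum.inl i) (p j) = if j = i then 1 else 0 := fun i j => by
    have : p j = b (Sum.inl j) := by rw [hb, Sum.elim_inl]
    rw [this, Basis.coord_apply, Basis.repr_self, Finsupp.single_apply]
    by_cases hji : j = i
    · subst hji; rw [if_pos rfl, if_pos rfl]
    · rw [if_neg (fun h => hji (Sum.inl_injective h)), if_neg hji]
  have hcoord_L : ∀ (i : Fin N), ∀ q ∈ L, b.coord (Sum.inl i) q = 0 := by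
    intro i q hq
    have hq' : q = ∑ j, qb.repr ⟨q, hq⟩ j • (qb j : V) := by
      have h := congrArg (Submodule.subtype L) (qb.sum_repr ⟨q, hq⟩).symm
      rw [map_sum] at h
      simpa only [Submodule.subtype_apply, map_smul] using h
    rw [hq', map_sum]
    exact Finset.sum_eq_zero fun j _ => by rw [map_smul, hcoord_q, smul_zero]
  -- (3) every `ι(q_j)`, hence `ι(L)`, is a contraction of `Θ`
  have hgen : ∀ j : Fin N, ι K (qb j : V) ∈ Submodule.span K {y : ExteriorAlgebra K V |
      ∃ φ ∈ {θ : Module.Dual K V | ∀ q ∈ L, θ q = 0}, y = contractLeft φ Θ} := by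
    intro j
    refine Submodule.subset_span ⟨b.coord (Sum.inl j), hcoord_L j, ?_⟩
    rw [hp, map_sum]
    simp_rw [contractLeft_ι_mul_ι_of_apply_eq_zero _ (hcoord_L j _ (qb _).2), hcoord_p j, ite_smul, one_smul, zero_smul,
      Finset.sum_ite_eq', Finset.mem_univ, if_true]
  intro l hl
  have hl' : l = ∑ j, qb.repr ⟨l, hl⟩ j • (qb j : V) := by
    have h := congrArg (Submodule.subtype L) (qb.sum_repr ⟨l, hl⟩).symm
    rw [map_sum] at h
    simpa only [Submodule.subtype_apply, map_smul] using h
  rw [hl', map_sum]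
  exact Submodule.sum_mem _ fun j _ => by rw [map_smul]; exact Submodule.smul_mem _ _ (hgen j)

end Summit.Ventures.HSemireg.WeilFrame

end
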